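import Summits.Ventures.PercRepro.SixThreePlane
import Summits.Ventures.PercRepro.SixThreeTriple
import Summits.Ventures.PercRepro.SixThreeColoop
import Summits.Ventures.PercRepro.SixThreeP1A
import Summits.Ventures.PercRepro.SixThreeP1B

/-!
# Theorem P₁′ for C-025 at `(6, 3)`: the per-triple lemma — the theorem (p5, gen 7)

Continuation of `SixThreeP1A.lean` / `SixThreeP1B.lean` (split for the ≤ 400-line lint; proofs byte-identical):
`P1_of_coloop` discharges the hypotheses of `P1_of_bounds` (the lossy share by p2's `share_triple_pair_ge`, the
closure property and the count from Mathlib's `Matroid` API, the repayment triple from the coloop lemma `(L4)` of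
`SixThreeColoop`), and `supply_ge_three` is the unconditional Theorem P₁′ in the shape of p2's `hP₁`
(`SixThreePlane.perPlane_of_six_le`): for `M` simple, `G` a plane, `T ∈ U_G` a triple and `W ⊆ E ∖ G` an
independent `6`-set, the witnesses `S` with `S ∩ G = T` and `S ∖ G ⊆ W` supply `Σ_S f(G, S) / D(S) ≥ 3`.
-/

namespace PercRepro

namespace SixThree

namespace P1

open Finset ThmH PerFlat

variable {α : Type*} [DecidableEq α] {M : Matroid α} [M.Finite]

/-- **Theorem P₁′** (mine-2 §19.4′) in the shape of p2's `hP₁` (`SixThreePlane.perPlane_of_six_le`), modulo the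
coloop lemma `(L4)`: `D(S ∪ y) ≤ D(S) + Λ(S)` for `y ∉ cl(S)` (p2's `D_insert_le_of_notMem_closure`).  For `G` a
plane, `T ∈ U_G` a triple and `W ⊆ E ∖ G` an independent `6`-set, the witnesses `S` with `S ∩ G = T` and
`S ∖ G ⊆ W` supply `Σ f(G, S) / D(S) ≥ 3`. -/
theorem P1_of_coloop (hs : Simple M) {G : Finset α} (hG : G ∈ planes M)
    (hL4 : ∀ S ⊆ gr M, ∀ y ∈ gr M, y ∉ clF M S → D M (insert y S) ≤ D M S + Lam M S) :
    ∀ T ∈ UqG M 6 3 G, T.card = 3 → ∀ W ⊆ gr M \ G, M.Indep (W : Set α) → W.card = 6 →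
      (3 : ℚ) ≤ ∑ S ∈ (Yq M 6 3).filter (fun S => S ∩ G = T ∧ S \ G ⊆ W), fRule M G S / D M S := by
  intro T hT hT3 W hWsub hWind hW6
  obtain ⟨⟨hTg, hrT, -⟩, hTG⟩ := mem_UqG_six_three.1 hT
  have hW : W ⊆ gr M := hWsub.trans Finset.sdiff_subset
  have hWG : Disjoint W G := Finset.disjoint_of_subset_left hWsub Finset.sdiff_disjoint
  have hWG' : ∀ x ∈ W, x ∉ G := fun x hx => Finset.disjoint_left.1 hWG hx
  exact P1_of_bounds hs hG hTG hrT hT3 hW hWG hW6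
    (fun x hx x' hx' hxx' _ => share_triple_pair_ge hs hG hTG hrT hT3 (hW hx) (hW hx') hxx'
      (hWG' x hx) (hWG' x' hx'))
    (fun x hx x' hx' _ hr => mem_clF_insert_of_eRk_eq_four hG hTG hrT (hW hx) (hW hx') (hWG' x hx) hr)
    (fun x hx x' hx' y hy hxx' _ _ hr hycl => triple_witness_of_coloop hs hG hTG hrT hT3 (hW hx)
      (hW hx') (hW hy) hxx' (hWG' x hx) (hWG' x' hx') (hWG' y hy) hr hycl
      (hL4 _ (Finset.insert_subset (hW hx) (Finset.insert_subset (hW hx') hTg)) y (hW hy) hycl))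
    (fun x hx x' hx' _ hr => two_le_card_repayment hG hTG hW hWind hW6 hx hx' hr)

/-- **Theorem P₁′** (mine-2 §19.4′, C-025 at `(6, 3)`), unconditional, in the shape of p2's `hP₁`
(`SixThreePlane.perPlane_of_six_le`): for `M` simple, `G` a plane, `T ∈ U_G` a triple and `W ⊆ E ∖ G` an independent
`6`-set, the witnesses `S` with `S ∩ G = T` and `S ∖ G ⊆ W` supply `Σ_S f(G, S) / D(S) ≥ 3`. -/
theorem supply_ge_three (hs : Simple M) {G : Finset α} (hG : G ∈ planes M) :
    ∀ T ∈ UqG M 6 3 G, T.card = 3 → ∀ W ⊆ gr M \ G, M.Indep (W : Set α) → W.card = 6 →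
      (3 : ℚ) ≤ ∑ S ∈ (Yq M 6 3).filter (fun S => S ∩ G = T ∧ S \ G ⊆ W), fRule M G S / D M S :=
  P1_of_coloop hs hG (fun _ hS _ hy hycl => D_insert_le_of_notMem_closure hS hy hycl)

end P1

end SixThree

end PercRepro
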